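import Literature.MathematicalPhysics.QuantumFieldTheory.Federbush1986.BallSmoothingDeriv

/-!
# `Federbush1986.DyadicSmoothing` — [Federbush1988PhaseCellIV] Appendix A, proof of Theorem A.3 (A.27)–(A.31) p. 342, the
# boundary-scale mollification `f_ε(x) = ∫ w^{εd(x)}(x − y) f(y) dy` (A.30) run over an ABSTRACT dyadic cutoff system (domain,
# size function `d`, cumulative cutoffs) — so that the same engine serves the unit BALL (Theorem A.3, Geometric Construction 5 as
# printed) and the unit CUBE (§11 Geometric Construction 5 (11.10)–(11.11), the cube version print actually uses) — PROVED

statement-level skeleton of published theorems with citation tags; proofs where landed; nothing here is a claim about the Yang–Mills mass gap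

CITATION HEADER.  P. Federbush, *A phase cell approach to Yang–Mills theory. IV. The choice of variables*, Commun. Math.
Phys. **114** (1988) 317–343 [Federbush1988PhaseCellIV], Appendix A part C, Theorem A.3 and its proof (A.27)–(A.31) p. 342,
and §11 Geometric Construction 5 (11.10)–(11.11) p. 338 (renders f4-p022/f4-p026 of unit `lit-balaban-r19`, read as images).
Cell `lit-balaban`, Phase-2 proof seat **r19 gen 11** (F4 fold owner); SKELETON row **F4.Def§11** (cell Geometric Construction
5, decl `PhaseCellIVGauge.GeomConstruction5`, typed p314251) — this file is engine 1/3 of its proof (2/3 `CubeCutoffs`, 3/3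
`PhaseCellIVGeomConstruction5`).  Inputs BY NAME: `LipschitzMollifier` (p258818: `moll`, `kernel`, `norm_moll_sub_le`,
`exists_bound_iteratedFDeriv_kernel`), `BallCutoffs` (p259125: `exists_level`), `BallSmoothing`/`BallSmoothingDeriv` (p04 g7:
the scales `hs`, the constants `Cm`/`Bc`/`Ac`, `norm_iteratedFDeriv_smul_le_of_scale`, `norm_iteratedFDeriv_moll_le'`,
`norm_sub_moll_le`).

WHAT IS PRINTED (p. 342).  «We also need a function `d(x) ∈ C^∞`, `d : B → R¹`, such that `½ d(x, ∂B) ≤ d(x) ≤ d(x, ∂B)`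
(A.29) … `f_ε(x) = ∫ dy w^{εd(x)}(x − y) f(y)` (A.30) … The distance between `f_ε(x)` and `M` in `R^t` can be made uniformly
small `d(f_ε(x), M) ≤ ε′` all `x` (A.31) for arbitrarily small `ε′` if `ε` is small enough. … The verification of (A.26) for
`f_ε` is straightforward.»  And p. 338: «`ᵉˢφ′` is a smoothing of `ᵉφ′`. *Geometric Construction 5.* … b) `|D^α ᵉˢφ′(x)| ≤ c_α
(1/(d(x, ∂D))^{|α|−1}) Λ₁(ᵉφ′)` (11.11)» — the same statement on a hypercube `H = D`.

WHAT THIS FILE DOES.  `BallSmoothing`/`BallSmoothingDeriv` (p04 g7) realise (A.30) on the ball with the scale frozen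
dyadically on the shells of the smooth function `θ = 1 − |x|²`: `f^{s′} = g + Σ_j ψ_j·(w^{ε2^{−j}} ⋆ g − g)`, `ψ_j = Θ_{j+1} − Θ_j`,
`Θ_j = smoothTransition(2^jθ − 1)`.  Their proofs use `θ` ONLY through (i) the level sets `{2^jθ ≤ 1} ⊆ {Θ_j = 0}`,
`{2^jθ ≥ 2} ⊆ {Θ_j = 1}`, (ii) the bounds `‖D^iΘ_j‖ ≤ P·2^{ji}`, (iii) `θ ≤ 1`, `θ ≤ 0` off the domain, the pinching `θ(y) ≤
2|y − x₁|` at points `x₁` with `θ(x₁) ≤ 0`, and the locality `B̄(x, θ(x)/2) ⊆ B̄`.  This file re-runs the SAME proofs, line by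
line, over a `CutoffSystem` = any triple (domain `D`, size function `σ`, cutoffs `Θ_j`) with exactly these properties as
fields — the size function is never differentiated, so NO smooth regularised distance is needed.  `CubeCutoffs` instantiates
it on the unit `k`-cube with `σ(x) = min_i min(x_i, 1 − x_i)` and the PRODUCT cutoffs `Θ_j(x) = Π_i χ(2^jx_i − 1)χ(2^j(1 − x_i) − 1)`.

WHAT THIS MODULE PROVIDES (namespace `DyadicSmoothing`): the structure `CutoffSystem n` (data + hypotheses, no assertion);
in namespace `CutoffSystem`: def `psi`, `smooth` (the operator `f^{s′}`), `partialSum`, `alt`; theorems `Θ_zero`,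
`Θ_eq_zero_of_nonpos`, `psi_*` (support, bounds `exists_psi_bound`), `smooth_eq_of_nonpos`, `smooth_eq_partialSum`,
`contDiffAt_smooth`, `contDiffOn_smooth`, **`norm_smooth_sub_le`** (`‖f^{s′} − g‖ ≤ 4εΛ₁σ`), `continuous_smooth`, `moll_congr`,
**`smooth_congr_of_eqOn`** (locality), **`norm_iteratedFDeriv_smooth_le`** / **`exists_deriv_bound`** (`‖D^i f^{s′}(x)‖ ≤
A·Λ₁·σ(x)^{−(i−1)}`).  No `Prop`-valued definition, no named fact; axioms standard.
-/

namespace Literature.MathematicalPhysics.QuantumFieldTheory.Federbush1986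

noncomputable section

open MeasureTheory Metric Set Filter Function
open scoped ContDiff Topology NNReal Convolution

namespace DyadicSmoothing

open LipschitzMollifier BallCutoffs BallSmoothing

variable {n : ℕ} {F : Type*} [NormedAddCommGroup F] [NormedSpace ℝ F]

/-! ## §1 The abstract dyadic cutoff system -/

/-- A **dyadic cutoff system** on `ℝⁿ`: a closed domain `D` (for locality), a continuous size function `σ` (print's `d(x)` of
(A.29)/(11.11) up to constants — positive exactly on the region to be smoothed, `≤ 1`, pinched at the points where it is
`≤ 0`, with `B̄(x, σ(x)/2) ⊆ D`), and `C^∞` cumulative cutoffs `Θ_j` with `0 ≤ Θ_j ≤ 1`, `Θ_j = 0` on `{2^jσ ≤ 1}`, `Θ_j = 1` on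
`{2^jσ ≥ 2}` and the scale-invariant bounds `‖D^iΘ_j‖ ≤ P_m 2^{ji}` on `D` (`i ≤ m`).  Instances: the unit ball with
`σ = 1 − |x|²`, `Θ_j = smoothTransition(2^jσ − 1)` (`BallCutoffs`); the unit cube with `σ = min_i min(x_i, 1 − x_i)` and product
cutoffs (`CubeCutoffs`).  A structure of data and hypotheses — nothing is asserted.
[cite: Federbush1988PhaseCellIV, (A.29)–(A.30) p. 342; (11.11) p. 338] -/
structure CutoffSystem (n : ℕ) where
  /-- the closed domain (`B̄`, resp. the closed cube `D`) -/
  D : Set (Euc n)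
  /-- the size function `σ ≍ d(x, ∂D)` on the region `{σ > 0}` to be smoothed -/
  σ : Euc n → ℝ
  /-- the cumulative cutoffs `Θ_j` -/
  Θ : ℕ → Euc n → ℝ
  /-- `σ` is continuous -/
  continuous_σ : Continuous σ
  /-- `σ ≤ 1` (dyadic levels start at `j = 1`) -/
  σ_le_one : ∀ x, σ x ≤ 1
  /-- pinching at the points where `σ ≤ 0` (in particular at `∂D`): `σ(y) ≤ 2|y − x₁|` -/
  pinch : ∀ x₁, σ x₁ ≤ 0 → ∀ y, σ y ≤ 2 * dist y x₁
  /-- locality: the ball of radius `σ(x)/2` about a point of the region stays in `D` -/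
  locality : ∀ x, 0 < σ x → closedBall x (σ x / 2) ⊆ D
  /-- `Θ_j ∈ C^∞(ℝⁿ)` -/
  contDiff_Θ : ∀ j, ContDiff ℝ ∞ (Θ j)
  /-- `0 ≤ Θ_j` -/
  Θ_nonneg : ∀ j x, 0 ≤ Θ j x
  /-- `Θ_j ≤ 1` -/
  Θ_le_one : ∀ j x, Θ j x ≤ 1
  /-- `Θ_j = 0` where `2^jσ ≤ 1` -/
  Θ_eq_zero : ∀ j x, (2 : ℝ) ^ j * σ x ≤ 1 → Θ j x = 0
  /-- `Θ_j = 1` where `2^jσ ≥ 2` -/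
  Θ_eq_one : ∀ j x, 2 ≤ (2 : ℝ) ^ j * σ x → Θ j x = 1
  /-- `‖D^iΘ_j(x)‖ ≤ P_m·2^{ji}` for `i ≤ m`, `x ∈ D` -/
  Θ_bound : ∀ m : ℕ, ∃ P : ℝ, 1 ≤ P ∧ ∀ j i, i ≤ m → ∀ x ∈ D, ‖iteratedFDeriv ℝ i (Θ j) x‖ ≤ P * (2 : ℝ) ^ (j * i)

namespace CutoffSystem

variable (S : CutoffSystem n)

/-- A point of the region lies in the domain. [cite: Federbush1988PhaseCellIV, (A.29) p. 342] -/
theorem mem_D_of_pos {x : Euc n} (hx : 0 < S.σ x) : x ∈ S.D :=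
  S.locality x hx (mem_closedBall_self (by positivity))

/-- `Θ_0 ≡ 0` (as `σ ≤ 1`). [cite: Federbush1988PhaseCellIV, (A.29)–(A.30) p. 342] -/
theorem Θ_zero (x : Euc n) : S.Θ 0 x = 0 := S.Θ_eq_zero 0 x (by simpa using S.σ_le_one x)

/-- `Θ_j = 0` where `σ ≤ 0` (off the region). [cite: Federbush1988PhaseCellIV, (A.29)–(A.30) p. 342] -/
theorem Θ_eq_zero_of_nonpos {j : ℕ} {x : Euc n} (hx : S.σ x ≤ 0) : S.Θ j x = 0 :=
  S.Θ_eq_zero j x ((mul_nonpos_of_nonneg_of_nonpos (by positivity) hx).trans zero_le_one)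

/-! ## §2 The partition of unity `ψ_j = Θ_{j+1} − Θ_j` of the region -/

/-- `ψ_j := Θ_{j+1} − Θ_j`, supported in the shell `2^{−j−1} ≤ σ ≤ 2^{1−j}`. [cite: Federbush1988PhaseCellIV, (A.29)–(A.30)
p. 342] -/
def psi (j : ℕ) (x : Euc n) : ℝ := S.Θ (j + 1) x - S.Θ j x

/-- `ψ_j ∈ C^∞`. [cite: Federbush1988PhaseCellIV, (A.29) p. 342] -/
theorem contDiff_psi (j : ℕ) : ContDiff ℝ ∞ (S.psi j) := (S.contDiff_Θ (j + 1)).sub (S.contDiff_Θ j)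

/-- `ψ_j(x) = 0` where `2^{j+1}σ(x) ≤ 1` (both cutoffs vanish). [cite: Federbush1988PhaseCellIV, (A.29)–(A.30) p. 342] -/
theorem psi_eq_zero_of_le {j : ℕ} {x : Euc n} (h : (2 : ℝ) ^ (j + 1) * S.σ x ≤ 1) : S.psi j x = 0 := by
  have h' : (2 : ℝ) ^ j * S.σ x ≤ 1 := by
    by_cases hθ : 0 ≤ S.σ x
    · calc (2 : ℝ) ^ j * S.σ x ≤ (2 : ℝ) ^ (j + 1) * S.σ x :=
            mul_le_mul_of_nonneg_right (pow_le_pow_right₀ (by norm_num) (Nat.le_succ j)) hθ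
        _ ≤ 1 := h
    · exact (mul_nonpos_of_nonneg_of_nonpos (by positivity) (le_of_not_ge hθ)).trans zero_le_one
  rw [psi, S.Θ_eq_zero _ _ h, S.Θ_eq_zero _ _ h', sub_zero]

/-- `ψ_j = 0` off the region `{σ > 0}`. [cite: Federbush1988PhaseCellIV, (A.29) p. 342] -/
theorem psi_eq_zero_of_nonpos {j : ℕ} {x : Euc n} (hx : S.σ x ≤ 0) : S.psi j x = 0 := by
  rw [psi, S.Θ_eq_zero_of_nonpos hx, S.Θ_eq_zero_of_nonpos hx, sub_zero]

/-- `ψ_j(x) = 0` where `2^jσ(x) ≥ 2` (both cutoffs equal `1`). [cite: Federbush1988PhaseCellIV, (A.29)–(A.30) p. 342] -/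
theorem psi_eq_zero_of_ge {j : ℕ} {x : Euc n} (h : 2 ≤ (2 : ℝ) ^ j * S.σ x) : S.psi j x = 0 := by
  have hθ : 0 ≤ S.σ x := by
    by_contra hθ
    have : (2 : ℝ) ^ j * S.σ x ≤ 0 := mul_nonpos_of_nonneg_of_nonpos (by positivity) (le_of_not_ge hθ)
    linarith
  have h' : 2 ≤ (2 : ℝ) ^ (j + 1) * S.σ x :=
    h.trans (mul_le_mul_of_nonneg_right (pow_le_pow_right₀ (by norm_num) (Nat.le_succ j)) hθ)
  rw [psi, S.Θ_eq_one _ _ h, S.Θ_eq_one _ _ h', sub_self]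

/-- `|ψ_j| ≤ 1`. [cite: Federbush1988PhaseCellIV, (A.27) p. 342] -/
theorem abs_psi_le_one (j : ℕ) (x : Euc n) : |S.psi j x| ≤ 1 := by
  rw [psi, abs_le]
  constructor <;> linarith [S.Θ_nonneg (j + 1) x, S.Θ_le_one (j + 1) x, S.Θ_nonneg j x, S.Θ_le_one j x]

/-- Telescoping: `Σ_{j<J} ψ_j = Θ_J` (as `Θ_0 = 0`). [cite: Federbush1988PhaseCellIV, (A.29)–(A.30) p. 342] -/
theorem sum_psi_range (J : ℕ) (x : Euc n) : ∑ j ∈ Finset.range J, S.psi j x = S.Θ J x := by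
  have := Finset.sum_range_sub (fun j => S.Θ j x) J
  simp only [psi]
  rw [this, S.Θ_zero, sub_zero]

/-- Partition of unity: `Σ_{j<J} ψ_j(x) = 1` where `2^Jσ(x) ≥ 2`. [cite: Federbush1988PhaseCellIV, (A.29)–(A.30) p. 342] -/
theorem sum_psi_eq_one {J : ℕ} {x : Euc n} (h : 2 ≤ (2 : ℝ) ^ J * S.σ x) : ∑ j ∈ Finset.range J, S.psi j x = 1 := by
  rw [sum_psi_range, S.Θ_eq_one _ _ h]

/-- `ψ_j ≡ 0` near any point with `2^{j+1}σ < 1`. [cite: Federbush1988PhaseCellIV, (A.29)–(A.30) p. 342] -/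
theorem psi_eventuallyEq_zero_of_lt {j : ℕ} {x : Euc n} (h : (2 : ℝ) ^ (j + 1) * S.σ x < 1) :
    S.psi j =ᶠ[𝓝 x] fun _ => 0 := by
  have hc : Continuous fun y : Euc n => (2 : ℝ) ^ (j + 1) * S.σ y := continuous_const.mul S.continuous_σ
  filter_upwards [hc.continuousAt.eventually_lt continuousAt_const h] with y hy using S.psi_eq_zero_of_le hy.le

/-- `ψ_j ≡ 0` near any point with `2^jσ > 2`. [cite: Federbush1988PhaseCellIV, (A.29)–(A.30) p. 342] -/
theorem psi_eventuallyEq_zero_of_gt {j : ℕ} {x : Euc n} (h : 2 < (2 : ℝ) ^ j * S.σ x) :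
    S.psi j =ᶠ[𝓝 x] fun _ => 0 := by
  have hc : Continuous fun y : Euc n => (2 : ℝ) ^ j * S.σ y := continuous_const.mul S.continuous_σ
  filter_upwards [continuousAt_const.eventually_lt hc.continuousAt h] with y hy using S.psi_eq_zero_of_ge hy.le

/-- **Derivative bounds for the partition.** `∃ P ≥ 0`: `‖D^iψ_j(x)‖ ≤ P·2^{ji}` for all `j`, `i ≤ m`, `x ∈ D`.
[cite: Federbush1988PhaseCellIV, (A.26)/(A.29) p. 342; (11.11) p. 338] -/
theorem exists_psi_bound (m : ℕ) : ∃ P : ℝ, 0 ≤ P ∧ ∀ j i, i ≤ m → ∀ x ∈ S.D,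
    ‖iteratedFDeriv ℝ i (S.psi j) x‖ ≤ P * (2 : ℝ) ^ (j * i) := by
  obtain ⟨P, hP1, hP⟩ := S.Θ_bound m
  refine ⟨(2 ^ m + 1) * P, by positivity, fun j i hi x hx => ?_⟩
  have hfun : S.psi j = S.Θ (j + 1) - S.Θ j := by ext y; rfl
  rw [hfun, iteratedFDeriv_sub_apply ((S.contDiff_Θ (j + 1)).of_le (mod_cast le_top)).contDiffAt
    ((S.contDiff_Θ j).of_le (mod_cast le_top)).contDiffAt]
  calc ‖iteratedFDeriv ℝ i (S.Θ (j + 1)) x - iteratedFDeriv ℝ i (S.Θ j) x‖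
      ≤ ‖iteratedFDeriv ℝ i (S.Θ (j + 1)) x‖ + ‖iteratedFDeriv ℝ i (S.Θ j) x‖ := norm_sub_le _ _
    _ ≤ P * (2 : ℝ) ^ ((j + 1) * i) + P * (2 : ℝ) ^ (j * i) := add_le_add (hP (j + 1) i hi x hx) (hP j i hi x hx)
    _ = (2 ^ i + 1) * P * (2 : ℝ) ^ (j * i) := by rw [add_mul (j : ℕ) 1 i, one_mul, pow_add]; ring
    _ ≤ (2 ^ m + 1) * P * (2 : ℝ) ^ (j * i) := by
        have h2 : (2 : ℝ) ^ i ≤ 2 ^ m := pow_le_pow_right₀ (by norm_num) hi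
        have hP0 : 0 ≤ P := by linarith
        apply mul_le_mul_of_nonneg_right _ (by positivity)
        exact mul_le_mul_of_nonneg_right (by linarith) hP0

/-! ## §3 Which cutoffs are alive at a point of level `J` (`2^{−J} < σ(x) ≤ 2·2^{−J}`) -/

/-- Above the level: `ψ_j(x) = 0` for `j ≥ J + 1` when `σ(x) > 2^{−J}`. [cite: Federbush1988PhaseCellIV, (A.30) p. 342] -/
theorem psi_eq_zero_above {J j : ℕ} {x : Euc n} (hJ : (1 / 2 : ℝ) ^ J < S.σ x) (hj : J + 1 ≤ j) : S.psi j x = 0 := by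
  apply S.psi_eq_zero_of_ge
  have hθ : 0 < S.σ x := lt_of_le_of_lt (by positivity) hJ
  have h1 : (2 : ℝ) ^ (J + 1) ≤ 2 ^ j := pow_le_pow_right₀ (by norm_num) hj
  have h2 : (2 : ℝ) ^ (J + 1) * (1 / 2 : ℝ) ^ J = 2 := by rw [pow_succ, mul_assoc, mul_comm 2, ← mul_assoc, ← mul_pow]; norm_num
  calc (2 : ℝ) = 2 ^ (J + 1) * (1 / 2 : ℝ) ^ J := h2.symm
    _ ≤ 2 ^ (J + 1) * S.σ x := mul_le_mul_of_nonneg_left hJ.le (by positivity)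
    _ ≤ 2 ^ j * S.σ x := mul_le_mul_of_nonneg_right h1 hθ.le

/-- Below the level: `ψ_j(x) = 0` for `j + 2 ≤ J` when `σ(x) ≤ 2·2^{−J}`. [cite: Federbush1988PhaseCellIV, (A.30) p. 342] -/
theorem psi_eq_zero_below {J j : ℕ} {x : Euc n} (hJ : S.σ x ≤ 2 * (1 / 2 : ℝ) ^ J) (hj : j + 2 ≤ J) : S.psi j x = 0 := by
  apply S.psi_eq_zero_of_le
  have h1 : (1 / 2 : ℝ) ^ J ≤ (1 / 2) ^ (j + 2) := pow_le_pow_of_le_one (by norm_num) (by norm_num) hj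
  have h2 : (2 : ℝ) ^ (j + 1) * (2 * (1 / 2 : ℝ) ^ (j + 2)) = 1 := by
    rw [show (2 : ℝ) * (1 / 2) ^ (j + 2) = (1 / 2) ^ (j + 1) by rw [pow_succ (1 / 2 : ℝ) (j + 1)]; ring, ← mul_pow]; norm_num
  calc (2 : ℝ) ^ (j + 1) * S.σ x ≤ 2 ^ (j + 1) * (2 * (1 / 2 : ℝ) ^ J) := by gcongr
    _ ≤ 2 ^ (j + 1) * (2 * (1 / 2 : ℝ) ^ (j + 2)) := by gcongr
    _ = 1 := h2

/-- Strictly below the level: `ψ_j ≡ 0` NEAR `x` for `j + 3 ≤ J` when `σ(x) ≤ 2·2^{−J}`. [cite: Federbush1988PhaseCellIV, (A.30)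
p. 342] -/
theorem psi_eventuallyEq_zero_below {J j : ℕ} {x : Euc n} (hJ : S.σ x ≤ 2 * (1 / 2 : ℝ) ^ J) (hj : j + 3 ≤ J) :
    S.psi j =ᶠ[𝓝 x] fun _ => 0 := by
  apply S.psi_eventuallyEq_zero_of_lt
  have h1 : (1 / 2 : ℝ) ^ J ≤ (1 / 2) ^ (j + 3) := pow_le_pow_of_le_one (by norm_num) (by norm_num) hj
  have h2 : (2 : ℝ) ^ (j + 1) * (2 * (1 / 2 : ℝ) ^ (j + 3)) = 1 / 2 := by
    rw [show (2 : ℝ) * (1 / 2) ^ (j + 3) = (1 / 2) ^ (j + 1) * (1 / 2) by rw [pow_succ, pow_succ]; ring, ← mul_assoc,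
      ← mul_pow]; norm_num
  calc (2 : ℝ) ^ (j + 1) * S.σ x ≤ 2 ^ (j + 1) * (2 * (1 / 2 : ℝ) ^ J) := by gcongr
    _ ≤ 2 ^ (j + 1) * (2 * (1 / 2 : ℝ) ^ (j + 3)) := by gcongr
    _ = 1 / 2 := h2
    _ < 1 := by norm_num

/-! ## §4 The smoothing operator `f^{s′}` (A.30) -/

/-- **`f^{s′}`**: `smooth ε g := g + Σ_j ψ_j·(w^{h_j} ⋆ g − g)`, `h_j = ε2^{−j} ≍ εσ(x)` on the shell of `ψ_j` ((A.30) with the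
scale frozen dyadically), `= g` off the region (boundary values (A.25)/(11.10)). [cite: Federbush1988PhaseCellIV, (A.25),
(A.30) p. 342; (11.10) p. 338] -/
def smooth (ε : ℝ) (g : Euc n → F) (x : Euc n) : F := g x + ∑' j, S.psi j x • (moll g (hs ε j) x - g x)

/-- The local finite form `Σ_{j≤J} ψ_j·(w^{h_j} ⋆ g)`. [cite: Federbush1988PhaseCellIV, (A.30) p. 342] -/
def partialSum (ε : ℝ) (g : Euc n → F) (J : ℕ) (x : Euc n) : F :=
  ∑ j ∈ Finset.range (J + 1), S.psi j x • moll g (hs ε j) x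

/-- Off the region `f^{s′} = g` ((A.25)/(11.10) boundary values). [cite: Federbush1988PhaseCellIV, (A.25) p. 342; (11.10)
p. 338] -/
theorem smooth_eq_of_nonpos {ε : ℝ} {g : Euc n → F} {x : Euc n} (hx : S.σ x ≤ 0) : S.smooth ε g x = g x := by
  unfold smooth
  simp [S.psi_eq_zero_of_nonpos hx]

/-- Finite form of the correction above level `J`. [cite: Federbush1988PhaseCellIV, (A.30) p. 342] -/
theorem smooth_sub_eq_sum {ε : ℝ} {g : Euc n → F} {J : ℕ} {x : Euc n} (hJ : (1 / 2 : ℝ) ^ J < S.σ x) :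
    S.smooth ε g x - g x = ∑ j ∈ Finset.range (J + 1), S.psi j x • (moll g (hs ε j) x - g x) := by
  unfold smooth
  rw [add_sub_cancel_left]
  refine tsum_eq_sum fun j hj => ?_
  rw [Finset.mem_range, not_lt] at hj
  rw [S.psi_eq_zero_above hJ hj, zero_smul]

/-- Local finite form: if `σ(x) > 2^{−J}` then `f^{s′}(x) = Σ_{j≤J} ψ_j(x)·(w^{h_j} ⋆ g)(x)`. [cite: Federbush1988PhaseCellIV,
(A.30) p. 342] -/
theorem smooth_eq_partialSum {ε : ℝ} {g : Euc n → F} {J : ℕ} {x : Euc n} (hJ : (1 / 2 : ℝ) ^ J < S.σ x) :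
    S.smooth ε g x = S.partialSum ε g J x := by
  have h1 := S.smooth_sub_eq_sum (ε := ε) (g := g) hJ
  have hone : ∑ j ∈ Finset.range (J + 1), S.psi j x = 1 := by
    apply S.sum_psi_eq_one
    have hθ : 0 < S.σ x := lt_of_le_of_lt (by positivity) hJ
    have : (2 : ℝ) ^ (J + 1) * (1 / 2 : ℝ) ^ J = 2 := by
      rw [pow_succ, mul_assoc, mul_comm 2, ← mul_assoc, ← mul_pow]; norm_num
    nlinarith [mul_le_mul_of_nonneg_left hJ.le (by positivity : (0 : ℝ) ≤ 2 ^ (J + 1))]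
  simp only [smul_sub, Finset.sum_sub_distrib, ← Finset.sum_smul, hone, one_smul] at h1
  unfold partialSum
  exact sub_left_inj.mp h1

/-- The local finite form holds on a neighbourhood. [cite: Federbush1988PhaseCellIV, (A.30) p. 342] -/
theorem smooth_eventuallyEq_partialSum {ε : ℝ} {g : Euc n → F} {J : ℕ} {x : Euc n} (hJ : (1 / 2 : ℝ) ^ J < S.σ x) :
    S.smooth ε g =ᶠ[𝓝 x] S.partialSum ε g J := by
  filter_upwards [continuousAt_const.eventually_lt S.continuous_σ.continuousAt hJ] with y hy
    using S.smooth_eq_partialSum hy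

/-- The local finite forms are `C^∞`. [cite: Federbush1988PhaseCellIV, (A.30) p. 342] -/
theorem contDiff_partialSum {ε : ℝ} {g : Euc n → F} (hg : Continuous g) (J : ℕ) : ContDiff ℝ ∞ (S.partialSum ε g J) := by
  unfold partialSum
  exact ContDiff.sum fun j _ => (S.contDiff_psi j).smul (contDiff_moll hg _)

/-- `f^{s′}` is `C^∞` at every point of the region. [cite: Federbush1988PhaseCellIV, Theorem A.3 p. 342; (11.11) p. 338] -/
theorem contDiffAt_smooth {ε : ℝ} {g : Euc n → F} (hg : Continuous g) {x : Euc n} (hx : 0 < S.σ x) :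
    ContDiffAt ℝ ∞ (S.smooth ε g) x := by
  obtain ⟨J, hJ⟩ := exists_pow_lt_of_lt_one hx (by norm_num : (1 / 2 : ℝ) < 1)
  exact ((S.contDiff_partialSum hg J).contDiffAt).congr_of_eventuallyEq (S.smooth_eventuallyEq_partialSum hJ)

/-- **`f^{s′} ∈ C^∞` on the region `{σ > 0}`.** [cite: Federbush1988PhaseCellIV, Theorem A.3 (A.26) p. 342; (11.11) p. 338] -/
theorem contDiffOn_smooth {ε : ℝ} {g : Euc n → F} (hg : Continuous g) : ContDiffOn ℝ ∞ (S.smooth ε g) {x | 0 < S.σ x} :=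
  fun _ hx => (S.contDiffAt_smooth hg hx).contDiffWithinAt

/-! ## §5 `f^{s′}` stays close to `g`: `‖f^{s′}(x) − g(x)‖ ≤ 4εΛ₁(g)σ(x)` ((A.31)) -/

/-- **`‖f^{s′}(x) − g(x)‖ ≤ 4εΛ₁(g)σ(x)`** on the region: only the two shells at the level of `x` contribute, each by
`≤ Λ₁(g)h_j < 2εΛ₁(g)σ(x)`. [cite: Federbush1988PhaseCellIV, (A.30)–(A.31) p. 342] -/
theorem norm_smooth_sub_le [CompleteSpace F] {ε : ℝ} (hε : 0 < ε) {g : Euc n → F} {K : ℝ≥0} (hg : LipschitzWith K g)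
    {x : Euc n} (hx : 0 < S.σ x) : ‖S.smooth ε g x - g x‖ ≤ 4 * ε * K * S.σ x := by
  obtain ⟨J, hJ1, hJlt, hJle⟩ := exists_level hx (S.σ_le_one x)
  rw [S.smooth_sub_eq_sum hJlt]
  have hsub : Finset.Icc (J - 1) J ⊆ Finset.range (J + 1) := by
    intro j hj
    rw [Finset.mem_Icc] at hj
    rw [Finset.mem_range]
    omega
  rw [← Finset.sum_subset hsub (fun j hj hj' => by
    rw [Finset.mem_range] at hj
    rw [Finset.mem_Icc, not_and_or, not_le, not_le] at hj'
    have hj2 : j + 2 ≤ J := by omega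
    rw [S.psi_eq_zero_below hJle hj2, zero_smul])]
  have hterm : ∀ j ∈ Finset.Icc (J - 1) J, ‖S.psi j x • (moll g (hs ε j) x - g x)‖ ≤ 2 * ε * K * S.σ x := by
    intro j hj
    rw [Finset.mem_Icc] at hj
    rw [norm_smul, Real.norm_eq_abs]
    have h1 : ‖moll g (hs ε j) x - g x‖ ≤ K * hs ε j := norm_moll_sub_le hg (hs_pos hε j) x
    have h2 : hs ε j ≤ 2 * hs ε J := by
      have := hs_mono hε (show J - 1 ≤ j from hj.1)
      have h3 : hs ε (J - 1) = 2 * hs ε J := by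
        obtain ⟨K', hK'⟩ := Nat.exists_eq_succ_of_ne_zero (Nat.one_le_iff_ne_zero.mp hJ1)
        subst hK'
        simp only [Nat.succ_sub_one, hs, pow_succ]
        ring
      linarith
    have h4 : hs ε J < ε * S.σ x := by unfold hs; exact mul_lt_mul_of_pos_left hJlt hε
    calc |S.psi j x| * ‖moll g (hs ε j) x - g x‖ ≤ 1 * (K * hs ε j) :=
          mul_le_mul (S.abs_psi_le_one j x) h1 (norm_nonneg _) zero_le_one
      _ ≤ 2 * ε * K * S.σ x := by nlinarith [K.coe_nonneg, hs_pos hε J]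
  calc ‖∑ j ∈ Finset.Icc (J - 1) J, S.psi j x • (moll g (hs ε j) x - g x)‖
      ≤ ∑ j ∈ Finset.Icc (J - 1) J, ‖S.psi j x • (moll g (hs ε j) x - g x)‖ := norm_sum_le _ _
    _ ≤ (Finset.Icc (J - 1) J).card • (2 * ε * K * S.σ x) := Finset.sum_le_card_nsmul _ _ _ hterm
    _ ≤ 2 • (2 * ε * K * S.σ x) := by
        have hc : (Finset.Icc (J - 1) J).card ≤ 2 := by rw [Nat.card_Icc]; omega
        have h0 : 0 ≤ 2 * ε * K * S.σ x := by
          have := hx.le; positivity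
        exact nsmul_le_nsmul_left h0 hc
    _ = 4 * ε * K * S.σ x := by rw [nsmul_eq_mul]; ring

/-- Global form: `‖f^{s′}(x) − g(x)‖ ≤ 4εΛ₁(g)·max(σ(x), 0)` for every `x`. [cite: Federbush1988PhaseCellIV, (A.30)–(A.31)
p. 342] -/
theorem norm_smooth_sub_le' [CompleteSpace F] {ε : ℝ} (hε : 0 < ε) {g : Euc n → F} {K : ℝ≥0} (hg : LipschitzWith K g)
    (x : Euc n) : ‖S.smooth ε g x - g x‖ ≤ 4 * ε * K * max (S.σ x) 0 := by
  by_cases hx : 0 < S.σ x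
  · exact (S.norm_smooth_sub_le hε hg hx).trans (by gcongr; exact le_max_left _ _)
  · rw [S.smooth_eq_of_nonpos (le_of_not_gt hx), sub_self, norm_zero]; positivity

/-! ## §6 Continuity of `f^{s′}` on all of `ℝⁿ` -/

/-- At a point `x₁` with `σ(x₁) ≤ 0` (e.g. on `∂D`): `‖f^{s′}(y) − f^{s′}(x₁)‖ ≤ (8ε + 1)Λ₁(g)‖y − x₁‖` (pinching `σ(y) ≤
2|y − x₁|`). [cite: Federbush1988PhaseCellIV, (A.25)/(A.30) p. 342; (11.10) p. 338] -/
theorem dist_smooth_le_of_nonpos [CompleteSpace F] {ε : ℝ} (hε : 0 < ε) {g : Euc n → F} {K : ℝ≥0}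
    (hg : LipschitzWith K g) {x₁ : Euc n} (hx₁ : S.σ x₁ ≤ 0) (y : Euc n) :
    dist (S.smooth ε g y) (S.smooth ε g x₁) ≤ (8 * ε + 1) * K * dist y x₁ := by
  rw [S.smooth_eq_of_nonpos hx₁]
  have hθ : max (S.σ y) 0 ≤ 2 * dist y x₁ := max_le (S.pinch x₁ hx₁ y) (by positivity)
  calc dist (S.smooth ε g y) (g x₁) ≤ dist (S.smooth ε g y) (g y) + dist (g y) (g x₁) := dist_triangle _ _ _
    _ ≤ 4 * ε * K * max (S.σ y) 0 + K * dist y x₁ := by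
        rw [dist_eq_norm]; exact add_le_add (S.norm_smooth_sub_le' hε hg y) (hg.dist_le_mul y x₁)
    _ ≤ 4 * ε * K * (2 * dist y x₁) + K * dist y x₁ := by gcongr
    _ = (8 * ε + 1) * K * dist y x₁ := by ring

/-- **`f^{s′}` is continuous on `ℝⁿ`** (smooth on the region, Lipschitz-pinched where `σ ≤ 0`) — in particular a continuous
mapping on the closed domain. [cite: Federbush1988PhaseCellIV, Theorem A.3 (A.25) p. 342; (11.10) p. 338] -/
theorem continuous_smooth [CompleteSpace F] {ε : ℝ} (hε : 0 < ε) {g : Euc n → F} {K : ℝ≥0} (hg : LipschitzWith K g) :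
    Continuous (S.smooth ε g) := by
  rw [continuous_iff_continuousAt]
  intro x
  by_cases hx : 0 < S.σ x
  · exact (S.contDiffAt_smooth (ε := ε) hg.continuous hx).continuousAt
  · rw [not_lt] at hx
    rw [Metric.continuousAt_iff]
    intro δ hδ
    refine ⟨δ / ((8 * ε + 1) * K + 1), by positivity, fun y hy => ?_⟩
    calc dist (S.smooth ε g y) (S.smooth ε g x) ≤ (8 * ε + 1) * K * dist y x := S.dist_smooth_le_of_nonpos hε hg hx y
      _ ≤ ((8 * ε + 1) * K + 1) * dist y x := by gcongr; linarith
      _ < ((8 * ε + 1) * K + 1) * (δ / ((8 * ε + 1) * K + 1)) := by gcongr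
      _ = δ := by field_simp

/-! ## §7 Locality: on `D`, `f^{s′}` only sees `g|_D` (for `ε ≤ 1/4`) -/

/-- The mollifier at `x` only sees `g` on `B̄(x, h)`. [cite: Federbush1988PhaseCellIV, (A.27) c), (A.30) p. 342] -/
theorem moll_congr {g₁ g₂ : Euc n → F} {h : ℝ} (hh : 0 < h) {x : Euc n}
    (heq : ∀ y ∈ closedBall x h, g₁ y = g₂ y) : moll g₁ h x = moll g₂ h x := by
  unfold moll
  simp only [convolution_def, ContinuousLinearMap.lsmul_apply]
  refine integral_congr_ae (Eventually.of_forall fun s => ?_)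
  by_cases hs : s ∈ closedBall (0 : Euc n) 1
  · have hmem : h • (h⁻¹ • x - s) ∈ closedBall x h := by
      rw [mem_closedBall, dist_zero_right] at hs
      rw [mem_closedBall, dist_eq_norm, smul_sub, smul_smul, mul_inv_cancel₀ hh.ne', one_smul, sub_sub_cancel_left, norm_neg,
        norm_smul, Real.norm_eq_abs, abs_of_pos hh]
      exact mul_le_of_le_one_right hh.le hs
    simp only [heq _ hmem]
  · simp only [kernel_eq_zero hs, zero_smul]

/-- A live cutoff at `x` forces `h_j < 2εσ(x)`. [cite: Federbush1988PhaseCellIV, (A.30) p. 342] -/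
theorem hs_lt_of_psi_ne_zero {ε : ℝ} (hε : 0 < ε) {j : ℕ} {x : Euc n} (hψ : S.psi j x ≠ 0) : hs ε j < 2 * ε * S.σ x := by
  have h1 : ¬ (2 : ℝ) ^ (j + 1) * S.σ x ≤ 1 := fun h => hψ (S.psi_eq_zero_of_le h)
  rw [not_le] at h1
  have h2 : (1 / 2 : ℝ) ^ j * 2 ^ (j + 1) = 2 := by rw [pow_succ, ← mul_assoc, ← mul_pow]; norm_num
  unfold hs
  have h3 : (1 / 2 : ℝ) ^ j < 2 * S.σ x := by
    have := mul_lt_mul_of_pos_left h1 (by positivity : (0 : ℝ) < (1 / 2) ^ j)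
    rw [mul_one, ← mul_assoc, h2] at this
    exact this
  nlinarith

/-- **Locality.** For `ε ≤ 1/4`, if `g₁ = g₂` on `D` then `smooth ε g₁ = smooth ε g₂` on `D` (every live mollification radius
`h_j < 2εσ(x) ≤ σ(x)/2` stays inside `D`). [cite: Federbush1988PhaseCellIV, (A.30) p. 342] -/
theorem smooth_congr_of_eqOn {ε : ℝ} (hε : 0 < ε) (hε4 : ε ≤ 1 / 4) {g₁ g₂ : Euc n → F}
    (heq : EqOn g₁ g₂ S.D) {x : Euc n} (hx : x ∈ S.D) :
    S.smooth ε g₁ x = S.smooth ε g₂ x := by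
  by_cases hσ : 0 < S.σ x
  · unfold smooth
    rw [heq hx]
    congr 1
    refine tsum_congr fun j => ?_
    by_cases hψ : S.psi j x = 0
    · rw [hψ, zero_smul, zero_smul]
    · congr 2
      refine moll_congr (hs_pos hε j) fun y hy => heq (S.locality x hσ ?_)
      rw [mem_closedBall] at hy ⊢
      have h1 := S.hs_lt_of_psi_ne_zero hε hψ
      nlinarith
  · rw [S.smooth_eq_of_nonpos (le_of_not_gt hσ), S.smooth_eq_of_nonpos (le_of_not_gt hσ), heq hx]

/-- Hence at a point of the region `smooth ε g₁` and `smooth ε g₂` agree near `x` (all derivatives coincide).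
[cite: Federbush1988PhaseCellIV, (A.30) p. 342] -/
theorem smooth_eventuallyEq_of_eqOn {ε : ℝ} (hε : 0 < ε) (hε4 : ε ≤ 1 / 4) {g₁ g₂ : Euc n → F}
    (heq : EqOn g₁ g₂ S.D) {x : Euc n} (hx : 0 < S.σ x) :
    S.smooth ε g₁ =ᶠ[𝓝 x] S.smooth ε g₂ := by
  filter_upwards [(isOpen_lt continuous_const S.continuous_σ).mem_nhds hx] with y hy
    using S.smooth_congr_of_eqOn hε hε4 heq (S.mem_D_of_pos hy)

/-! ## §8 The derivative bounds (A.26)/(11.11) for `f^{s′}` -/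

/-- The re-centred local form `w^{h_J} ⋆ g + Σ_{j≤J} ψ_j·(w^{h_j} ⋆ g − w^{h_J} ⋆ g)`. [cite: Federbush1988PhaseCellIV, (A.30)
p. 342] -/
def alt (ε : ℝ) (g : Euc n → F) (J : ℕ) (y : Euc n) : F :=
  moll g (hs ε J) y + ∑ j ∈ Finset.range (J + 1), S.psi j y • (moll g (hs ε j) y - moll g (hs ε J) y)

/-- On `{σ > 2^{−J}}` the local finite form equals the re-centred one (partition of unity).
[cite: Federbush1988PhaseCellIV, (A.30) p. 342] -/
theorem partialSum_eq_alt {ε : ℝ} {g : Euc n → F} {J : ℕ} {y : Euc n} (hJ : (1 / 2 : ℝ) ^ J < S.σ y) :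
    S.partialSum ε g J y = S.alt ε g J y := by
  have hone : ∑ j ∈ Finset.range (J + 1), S.psi j y = 1 := by
    apply S.sum_psi_eq_one
    have hθ : 0 < S.σ y := lt_of_le_of_lt (by positivity) hJ
    have h2 : (2 : ℝ) ^ (J + 1) * (1 / 2 : ℝ) ^ J = 2 := by
      rw [pow_succ, mul_assoc, mul_comm 2, ← mul_assoc, ← mul_pow]; norm_num
    calc (2 : ℝ) = 2 ^ (J + 1) * (1 / 2 : ℝ) ^ J := h2.symm
      _ ≤ 2 ^ (J + 1) * S.σ y := mul_le_mul_of_nonneg_left hJ.le (by positivity)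
  unfold partialSum alt
  simp only [smul_sub, Finset.sum_sub_distrib, ← Finset.sum_smul, hone, one_smul]
  abel

/-- Near a point of level `J`, `f^{s′}` is the re-centred local form. [cite: Federbush1988PhaseCellIV, (A.30) p. 342] -/
theorem smooth_eventuallyEq_alt {ε : ℝ} {g : Euc n → F} {J : ℕ} {x : Euc n} (hJ : (1 / 2 : ℝ) ^ J < S.σ x) :
    S.smooth ε g =ᶠ[𝓝 x] S.alt ε g J := by
  filter_upwards [S.smooth_eventuallyEq_partialSum (ε := ε) (g := g) hJ,
    continuousAt_const.eventually_lt S.continuous_σ.continuousAt hJ] with y hy hy'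
  rw [hy, S.partialSum_eq_alt hy']

/-- **One shell term.** For `j ≤ J ≤ j + 2` at a point `x ∈ D`: `‖D^i(ψ_j·(w^{h_j} ⋆ g − w^{h_J} ⋆ g))(x)‖ ≤ Bc_i·Λ₁(g)·h_J^{−(i−1)}`.
[cite: Federbush1988PhaseCellIV, Theorem A.3 (A.26) p. 342; (11.11) p. 338] -/
theorem norm_iteratedFDeriv_term_le [CompleteSpace F] {ε : ℝ} (hε : 0 < ε) {m : ℕ} {P : ℝ}
    (hP : ∀ j l, l ≤ m → ∀ x ∈ S.D, ‖iteratedFDeriv ℝ l (S.psi j) x‖ ≤ P * 2 ^ (j * l))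
    {Ak : ℕ → ℝ} (hAk : ∀ k t, ‖iteratedFDeriv ℝ k (kernel n) t‖ ≤ Ak k)
    {g : Euc n → F} {K : ℝ≥0} (hg : LipschitzWith K g) {i : ℕ} (hi1 : 1 ≤ i) (him : i ≤ m)
    {x : Euc n} (hx : x ∈ S.D) {J j : ℕ} (hjJ : j ≤ J) (hJj : J ≤ j + 2) :
    ‖iteratedFDeriv ℝ i (fun y => S.psi j y • (moll g (hs ε j) y - moll g (hs ε J) y)) x‖ ≤
      Bc n P Ak ε i * K * ((hs ε J)⁻¹) ^ (i - 1) := by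
  set a := hs ε J with ha_def
  have ha : 0 < a := hs_pos hε J
  have hgc : Continuous g := hg.continuous
  have hv : ContDiff ℝ ∞ fun y => moll g (hs ε j) y - moll g (hs ε J) y := (contDiff_moll hgc _).sub (contDiff_moll hgc _)
  have hQ : ∀ l ≤ i, ‖iteratedFDeriv ℝ l (S.psi j) x‖ ≤ (P * ε ^ l) * (a⁻¹) ^ l := by
    intro l hl
    refine (hP j l (hl.trans him) x hx).trans ?_
    have h2j : (2 : ℝ) ^ (j * l) ≤ 2 ^ (J * l) := pow_le_pow_right₀ (by norm_num) (Nat.mul_le_mul_right l hjJ)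
    have h2J : (2 : ℝ) ^ (J * l) = ε ^ l * (a⁻¹) ^ l := by rw [pow_mul, two_pow_eq hε J, mul_pow]
    have hP0 : 0 ≤ P := by
      have := (norm_nonneg _).trans (hP j 0 (Nat.zero_le m) x hx)
      simpa using this
    calc P * (2 : ℝ) ^ (j * l) ≤ P * 2 ^ (J * l) := mul_le_mul_of_nonneg_left h2j hP0
      _ = P * ε ^ l * (a⁻¹) ^ l := by rw [h2J, mul_assoc]
  have hR0 : ‖moll g (hs ε j) x - moll g (hs ε J) x‖ ≤ (5 * K) * a := norm_sub_moll_le hε hg hJj x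
  have hR : ∀ b, 1 ≤ b → b ≤ i →
      ‖iteratedFDeriv ℝ b (fun y => moll g (hs ε j) y - moll g (hs ε J) y) x‖ ≤ (2 * Cm n Ak (b - 1) * K) * (a⁻¹) ^ (b - 1) := by
    intro b hb1 _
    have hfun : (fun y => moll g (hs ε j) y - moll g (hs ε J) y) = moll g (hs ε j) - moll g (hs ε J) := rfl
    rw [hfun, iteratedFDeriv_sub_apply ((contDiff_moll hgc _).of_le (mod_cast le_top)).contDiffAt
      ((contDiff_moll hgc _).of_le (mod_cast le_top)).contDiffAt]
    have h1 := norm_iteratedFDeriv_moll_le' hAk hg (hs_pos hε j) hb1 x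
    have h2 := norm_iteratedFDeriv_moll_le' hAk hg ha hb1 x
    have hja : a ≤ hs ε j := hs_mono hε hjJ
    have hinv : (hs ε j)⁻¹ ^ (b - 1) ≤ (a⁻¹) ^ (b - 1) :=
      pow_le_pow_left₀ (inv_nonneg.2 (hs_pos hε j).le) ((inv_le_inv₀ (hs_pos hε j) ha).2 hja) _
    have hC0 : 0 ≤ Cm n Ak (b - 1) * K :=
      mul_nonneg (mul_nonneg (vB_nonneg _ _) ((norm_nonneg _).trans (hAk (b - 1) 0))) K.coe_nonneg
    calc ‖iteratedFDeriv ℝ b (moll g (hs ε j)) x - iteratedFDeriv ℝ b (moll g (hs ε J)) x‖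
        ≤ ‖iteratedFDeriv ℝ b (moll g (hs ε j)) x‖ + ‖iteratedFDeriv ℝ b (moll g (hs ε J)) x‖ := norm_sub_le _ _
      _ ≤ Cm n Ak (b - 1) * K * (hs ε j)⁻¹ ^ (b - 1) + Cm n Ak (b - 1) * K * (a⁻¹) ^ (b - 1) := add_le_add h1 h2
      _ ≤ Cm n Ak (b - 1) * K * (a⁻¹) ^ (b - 1) + Cm n Ak (b - 1) * K * (a⁻¹) ^ (b - 1) := by gcongr
      _ = 2 * Cm n Ak (b - 1) * K * (a⁻¹) ^ (b - 1) := by ring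
  have key := norm_iteratedFDeriv_smul_le_of_scale (S.contDiff_psi j) hv hi1 ha (Q := fun l => P * ε ^ l)
    (R := fun b => 2 * Cm n Ak (b - 1) * K) hQ hR0 hR
  refine key.trans (le_of_eq ?_)
  unfold Bc
  rw [add_mul _ _ (K : ℝ), Finset.sum_mul]
  congr 1
  congr 1
  · refine Finset.sum_congr rfl fun l _ => ?_
    ring
  · ring

/-- **(A.26)/(11.11) for `f^{s′}`, explicit constants.** For `x` in the region and `1 ≤ i ≤ m`:
`‖D^i(smooth ε g)(x)‖ ≤ Ac_i·Λ₁(g)·σ(x)^{−(i−1)}`. [cite: Federbush1988PhaseCellIV, Theorem A.3 (A.26) p. 342; (11.11) p. 338] -/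
theorem norm_iteratedFDeriv_smooth_le [CompleteSpace F] {ε : ℝ} (hε : 0 < ε) {m : ℕ} {P : ℝ} (hP0 : 0 ≤ P)
    (hP : ∀ j l, l ≤ m → ∀ x ∈ S.D, ‖iteratedFDeriv ℝ l (S.psi j) x‖ ≤ P * 2 ^ (j * l))
    {Ak : ℕ → ℝ} (hAk0 : ∀ k, 0 ≤ Ak k) (hAk : ∀ k t, ‖iteratedFDeriv ℝ k (kernel n) t‖ ≤ Ak k)
    {g : Euc n → F} {K : ℝ≥0} (hg : LipschitzWith K g) {i : ℕ} (hi1 : 1 ≤ i) (him : i ≤ m)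
    {x : Euc n} (hx : 0 < S.σ x) :
    ‖iteratedFDeriv ℝ i (S.smooth ε g) x‖ ≤ Ac n P Ak ε i * K * ((S.σ x)⁻¹) ^ (i - 1) := by
  have hxc : x ∈ S.D := S.mem_D_of_pos hx
  obtain ⟨J, _, hJlt, hJle⟩ := exists_level hx (S.σ_le_one x)
  set a := hs ε J with ha_def
  have ha : 0 < a := hs_pos hε J
  have hgc : Continuous g := hg.continuous
  rw [((S.smooth_eventuallyEq_alt (ε := ε) (g := g) hJlt).iteratedFDeriv ℝ i).eq_of_nhds]
  have hmollJ : ContDiff ℝ ∞ (moll g a) := contDiff_moll hgc _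
  have hterm : ∀ j, ContDiff ℝ ∞ fun y => S.psi j y • (moll g (hs ε j) y - moll g (hs ε J) y) := fun j =>
    (S.contDiff_psi j).smul ((contDiff_moll hgc _).sub (contDiff_moll hgc _))
  have hsplit : iteratedFDeriv ℝ i (S.alt ε g J) x = iteratedFDeriv ℝ i (moll g a) x +
      ∑ j ∈ Finset.range (J + 1), iteratedFDeriv ℝ i (fun y => S.psi j y • (moll g (hs ε j) y - moll g (hs ε J) y)) x := by
    have hsum : ContDiff ℝ ∞ fun y => ∑ j ∈ Finset.range (J + 1), S.psi j y • (moll g (hs ε j) y - moll g (hs ε J) y) :=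
      ContDiff.sum fun j _ => hterm j
    unfold alt
    rw [fun_iteratedFDeriv_add_apply (hmollJ.of_le (mod_cast le_top)).contDiffAt (hsum.of_le (mod_cast le_top)).contDiffAt,
      iteratedFDeriv_fun_sum_apply fun j _ => ((hterm j).of_le (mod_cast le_top)).contDiffAt]
  rw [hsplit]
  have h1 : ‖iteratedFDeriv ℝ i (moll g a) x‖ ≤ Cm n Ak (i - 1) * K * (a⁻¹) ^ (i - 1) :=
    norm_iteratedFDeriv_moll_le' hAk hg ha hi1 x
  have hsub : Finset.Icc (J - 2) J ⊆ Finset.range (J + 1) := by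
    intro j hj; rw [Finset.mem_Icc] at hj; rw [Finset.mem_range]; omega
  have hvanish : ∀ j ∈ Finset.range (J + 1), j ∉ Finset.Icc (J - 2) J →
      iteratedFDeriv ℝ i (fun y => S.psi j y • (moll g (hs ε j) y - moll g (hs ε J) y)) x = 0 := by
    intro j hj hj'
    rw [Finset.mem_range] at hj
    rw [Finset.mem_Icc, not_and_or, not_le, not_le] at hj'
    have hj3 : j + 3 ≤ J := by omega
    have hev : (fun y => S.psi j y • (moll g (hs ε j) y - moll g (hs ε J) y)) =ᶠ[𝓝 x] fun _ => (0 : F) := by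
      filter_upwards [S.psi_eventuallyEq_zero_below hJle hj3] with y hy
      rw [hy, zero_smul]
    rw [(hev.iteratedFDeriv ℝ i).eq_of_nhds, iteratedFDeriv_fun_zero, Pi.zero_apply]
  rw [← Finset.sum_subset hsub hvanish]
  have h2 : ∀ j ∈ Finset.Icc (J - 2) J,
      ‖iteratedFDeriv ℝ i (fun y => S.psi j y • (moll g (hs ε j) y - moll g (hs ε J) y)) x‖ ≤
        Bc n P Ak ε i * K * (a⁻¹) ^ (i - 1) := by
    intro j hj
    rw [Finset.mem_Icc] at hj
    exact S.norm_iteratedFDeriv_term_le hε hP hAk hg hi1 him hxc hj.2 (by omega)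
  have hcard : (Finset.Icc (J - 2) J).card ≤ 3 := by rw [Nat.card_Icc]; omega
  have hB0 : 0 ≤ Bc n P Ak ε i * K * (a⁻¹) ^ (i - 1) := by
    have := Bc_nonneg (n := n) hP0 hAk0 hε i; positivity
  have h3 : ‖∑ j ∈ Finset.Icc (J - 2) J,
      iteratedFDeriv ℝ i (fun y => S.psi j y • (moll g (hs ε j) y - moll g (hs ε J) y)) x‖ ≤
        3 * (Bc n P Ak ε i * K * (a⁻¹) ^ (i - 1)) := by
    refine (norm_sum_le _ _).trans ((Finset.sum_le_card_nsmul _ _ _ h2).trans ?_)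
    rw [nsmul_eq_mul]
    exact mul_le_mul_of_nonneg_right (by exact_mod_cast hcard) hB0
  have hscale : (a⁻¹) ^ (i - 1) ≤ (2 / ε) ^ (i - 1) * ((S.σ x)⁻¹) ^ (i - 1) := by
    rw [← mul_pow]
    refine pow_le_pow_left₀ (inv_nonneg.2 ha.le) ?_ _
    have hεθ : ε * S.σ x / 2 ≤ a := by
      rw [ha_def, hs]
      nlinarith
    calc a⁻¹ ≤ (ε * S.σ x / 2)⁻¹ := (inv_le_inv₀ ha (by positivity)).2 hεθ
      _ = 2 / ε * (S.σ x)⁻¹ := by field_simp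
  have hC0 : 0 ≤ (Cm n Ak (i - 1) + 3 * Bc n P Ak ε i) * K := by
    have := Cm_nonneg (n := n) hAk0 (i - 1)
    have := Bc_nonneg (n := n) hP0 hAk0 hε i
    positivity
  calc ‖iteratedFDeriv ℝ i (moll g a) x + ∑ j ∈ Finset.Icc (J - 2) J,
        iteratedFDeriv ℝ i (fun y => S.psi j y • (moll g (hs ε j) y - moll g (hs ε J) y)) x‖
      ≤ Cm n Ak (i - 1) * K * (a⁻¹) ^ (i - 1) + 3 * (Bc n P Ak ε i * K * (a⁻¹) ^ (i - 1)) :=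
        (norm_add_le _ _).trans (add_le_add h1 h3)
    _ = ((Cm n Ak (i - 1) + 3 * Bc n P Ak ε i) * K) * (a⁻¹) ^ (i - 1) := by ring
    _ ≤ ((Cm n Ak (i - 1) + 3 * Bc n P Ak ε i) * K) * ((2 / ε) ^ (i - 1) * ((S.σ x)⁻¹) ^ (i - 1)) :=
        mul_le_mul_of_nonneg_left hscale hC0
    _ = Ac n P Ak ε i * K * ((S.σ x)⁻¹) ^ (i - 1) := by unfold Ac; ring

/-- **Theorem A.3 (A.26) / Construction 5 (11.11) for `f^{s′}` (before the projection onto `M`).** For every cutoff system,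
every order cap `m` and every `ε > 0` there is `A = A(S, m, ε) ≥ 0` such that for EVERY `Λ₁`-Lipschitz `g : ℝⁿ → F`, every
`1 ≤ i ≤ m` and every `x` of the region, `‖D^i(smooth ε g)(x)‖ ≤ A·Λ₁·σ(x)^{−(i−1)}`.
[cite: Federbush1988PhaseCellIV, Theorem A.3 (A.26) p. 342; (11.11) p. 338] -/
theorem exists_deriv_bound [CompleteSpace F] (m : ℕ) {ε : ℝ} (hε : 0 < ε) : ∃ A : ℝ, 0 ≤ A ∧
    ∀ (g : Euc n → F) (K : ℝ≥0), LipschitzWith K g → ∀ i, 1 ≤ i → i ≤ m →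
    ∀ x, 0 < S.σ x → ‖iteratedFDeriv ℝ i (S.smooth ε g) x‖ ≤ A * K * ((S.σ x)⁻¹) ^ (i - 1) := by
  obtain ⟨P, hP0, hP⟩ := S.exists_psi_bound m
  have hker : ∀ k, ∃ A : ℝ, 0 ≤ A ∧ ∀ t : Euc n, ‖iteratedFDeriv ℝ k (kernel n) t‖ ≤ A := fun k =>
    exists_bound_iteratedFDeriv_kernel (n := n) k
  choose Ak hAk0 hAk using hker
  refine ⟨∑ i ∈ Finset.range (m + 1), Ac n P Ak ε i, Finset.sum_nonneg fun i _ => Ac_nonneg hP0 hAk0 hε i,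
    fun g K hg i hi1 him x hx => ?_⟩
  have hle : Ac n P Ak ε i ≤ ∑ i ∈ Finset.range (m + 1), Ac n P Ak ε i :=
    Finset.single_le_sum (fun i _ => Ac_nonneg hP0 hAk0 hε i) (by rw [Finset.mem_range]; omega)
  calc ‖iteratedFDeriv ℝ i (S.smooth ε g) x‖ ≤ Ac n P Ak ε i * K * ((S.σ x)⁻¹) ^ (i - 1) :=
        S.norm_iteratedFDeriv_smooth_le hε hP0 hP hAk0 hAk hg hi1 him hx
    _ ≤ (∑ i ∈ Finset.range (m + 1), Ac n P Ak ε i) * K * ((S.σ x)⁻¹) ^ (i - 1) := by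
        have hθ := hx.le
        gcongr

end CutoffSystem

end DyadicSmoothing

end

end Literature.MathematicalPhysics.QuantumFieldTheory.Federbush1986
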